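import Literature.MathematicalPhysics.KineticTheory.AdmissibleCellGeometry
import Literature.MathematicalPhysics.KineticTheory.HardSphereCanonicalClusterBound
import HarnessLib

/-!
# Large deviations of the cell occupancies of the uniform hard-sphere gas (Ruelle bound)

Topic `Literature/MathematicalPhysics/KineticTheory` (kind proof; companion of `HardSphereCanonicalClusterBound.lean`
and `AdmissibleCellGeometry.lean`).  For `N + 1` hard spheres of diameter `σ(N+1)^{-1/3}` on `𝕋³` under the
configurational canonical Gibbs measure with unit activity, at small reduced density, the probability that the
`r'`-cell of some particle contains more than `κ (N+1) r'³` particles (i.e. has cell density `n > κ`) is bounded by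
the Ruelle-type few-label bound (`posGibbs_le_two_pow_mul_pi`: an event involving `M + 1` labels has canonical
probability at most `2^{M+1}` times its independent probability) summed over the `M`-subsets of partners:

  `P_N(∃ j, κ(N+1)r'³ < #{l : cell_l = cell_j}) ≤ (N+1) · C(N, M) · 2^{M+1} · (r'³)^M`,  `M = ⌊κ(N+1)r'³⌋`

(`posGibbs_exists_denseCell_le`), since `M` independent uniform points all fall into the cell of a given point with
probability `≤ (r'³)^M` (`pi_forall_sameCell_le`: every cell has volume `≤ r'³` and the cells partition the torus).
For `κ ≥ 6 > 2e` the right side, even multiplied by `(N+1)`, tends to `0` exponentially fast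
(`tendsto_denseCell_bound`: `C(N,M) ≤ (N+1)^M/M!`, `(M+1)^{M+1}/(M+1)! ≤ e^{M+1}`), which is what a union bound over
the `O((N+1)^{1/3})` windows of the crux line `Sketch` of `InformationPercolationEngine.CollisionRate`
(stmt-AtomisticToContinuum-13481, `stub_mesoscaleRegularityConst`) consumes (`exists_forall_succ_mul_posGibbs_real_le`).

## References

* D. Ruelle, *Statistical Mechanics: Rigorous Results* (1969), §4.2 (bounds on the correlation functions of a
  hard-core gas).  [Ruelle1969]
-/

noncomputable section

namespace Literature.MathematicalPhysics.KineticTheory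

open _root_.MeasureTheory Set Filter _root_.Topology Finset
open scoped ENNReal BigOperators
open Literature.Analysis.FluidPDE Literature.MathematicalPhysics.StatisticalMechanics

/-! ## The independent probability that given particles share the cell of particle `j` -/

/-- The event that particles `b` and `j` lie in the same `r'`-cell is measurable. [folklore] -/
theorem measurableSet_sameCell {n : ℕ} (r' : ℝ) (b j : Fin n) :
    MeasurableSet {x : Fin n → T3 | Torus.coarseCell r' (x b) = Torus.coarseCell r' (x j)} := by
  have hset : {x : Fin n → T3 | Torus.coarseCell r' (x b) = Torus.coarseCell r' (x j)} =
      ⋃ e : Fin 3 → ℤ, ((fun x : Fin n → T3 => x b) ⁻¹' cellSet r' e ∩ (fun x : Fin n → T3 => x j) ⁻¹' cellSet r' e) := by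
    ext x
    simp only [mem_setOf_eq, mem_iUnion, mem_inter_iff, Set.mem_preimage, cellSet]
    exact ⟨fun h => ⟨_, h, rfl⟩, fun ⟨e, hb, hj⟩ => hb.trans hj.symm⟩
  rw [hset]
  exact MeasurableSet.iUnion fun e =>
    ((measurable_pi_apply b) (measurableSet_cellSet r' e)).inter ((measurable_pi_apply j) (measurableSet_cellSet r' e))

/-- The event that all particles of `B` lie in the cell of particle `j` is measurable. [folklore] -/
theorem measurableSet_forall_sameCell {n : ℕ} (r' : ℝ) (B : Finset (Fin n)) (j : Fin n) :
    MeasurableSet {x : Fin n → T3 | ∀ b ∈ B, Torus.coarseCell r' (x b) = Torus.coarseCell r' (x j)} := by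
  have hset : {x : Fin n → T3 | ∀ b ∈ B, Torus.coarseCell r' (x b) = Torus.coarseCell r' (x j)} =
      ⋂ b ∈ B, {x : Fin n → T3 | Torus.coarseCell r' (x b) = Torus.coarseCell r' (x j)} := by
    ext x; simp
  rw [hset]
  exact MeasurableSet.biInter B.countable_toSet fun b _ => measurableSet_sameCell r' b j

/-- **`M` independent uniform points all fall into the cell of a given further point with probability `≤ (r'³)^M`**:
condition on the cell `e` of `x_j`; the box event `{x_j ∈ e, x_b ∈ e ∀ b ∈ B}` has product measure `vol(e)^{#B+1}`,
`vol(e) ≤ r'³` (`volume_cellSet_le`) and `Σ_e vol(e) = 1` (`tsum_volume_cellSet`). [folklore] -/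
theorem pi_forall_sameCell_le {n : ℕ} {r' : ℝ} (hr : 0 < r') {B : Finset (Fin n)} {j : Fin n} (hj : j ∉ B) :
    Measure.pi (fun _ : Fin n => (volume : Measure T3))
        {x : Fin n → T3 | ∀ b ∈ B, Torus.coarseCell r' (x b) = Torus.coarseCell r' (x j)} ≤
      ENNReal.ofReal (r' ^ 3) ^ B.card := by
  classical
  set box : (Fin 3 → ℤ) → Set (Fin n → T3) := fun e =>
    Set.pi univ (fun l => if l ∈ insert j B then cellSet r' e else univ) with hbox
  have hsub : {x : Fin n → T3 | ∀ b ∈ B, Torus.coarseCell r' (x b) = Torus.coarseCell r' (x j)} ⊆ ⋃ e, box e := by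
    intro x hx
    refine mem_iUnion.2 ⟨Torus.coarseCell r' (x j), ?_⟩
    rw [hbox, mem_univ_pi]
    intro l
    by_cases hl : l ∈ insert j B
    · rw [if_pos hl]
      rcases Finset.mem_insert.1 hl with rfl | hb
      · rfl
      · exact hx l hb
    · rw [if_neg hl]; trivial
  have hboxvol : ∀ e, Measure.pi (fun _ : Fin n => (volume : Measure T3)) (box e) = volume (cellSet r' e) ^ (B.card + 1) := by
    intro e
    rw [hbox, Measure.pi_pi]
    simp only [apply_ite, measure_univ]
    rw [Finset.prod_ite_mem, Finset.univ_inter, Finset.prod_const, Finset.card_insert_of_notMem hj]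
  calc Measure.pi (fun _ : Fin n => (volume : Measure T3))
        {x : Fin n → T3 | ∀ b ∈ B, Torus.coarseCell r' (x b) = Torus.coarseCell r' (x j)}
      ≤ Measure.pi (fun _ : Fin n => (volume : Measure T3)) (⋃ e, box e) := measure_mono hsub
    _ ≤ ∑' e, Measure.pi (fun _ : Fin n => (volume : Measure T3)) (box e) := measure_iUnion_le _
    _ = ∑' e, volume (cellSet r' e) ^ (B.card + 1) := by simp_rw [hboxvol]
    _ ≤ ∑' e, volume (cellSet r' e) * ENNReal.ofReal (r' ^ 3) ^ B.card := by
        refine ENNReal.tsum_le_tsum fun e => ?_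
        rw [pow_succ']
        exact mul_le_mul_right (pow_le_pow_left' (volume_cellSet_le hr e) _) _
    _ = (∑' e, volume (cellSet r' e)) * ENNReal.ofReal (r' ^ 3) ^ B.card := ENNReal.tsum_mul_right
    _ = ENNReal.ofReal (r' ^ 3) ^ B.card := by rw [tsum_volume_cellSet, one_mul]

/-! ## The canonical bounds -/

variable {σ : ℝ}

/-- **Ruelle bound for the same-cell event**: at small density, the canonical probability that all particles of `B`
lie in the cell of `j ∉ B` is at most `2^{#B+1} (r'³)^{#B}`. [cite: Ruelle1969, §4.2] -/
theorem posGibbs_forall_sameCell_le (h : SmallDensity uniformProfile σ) {N : ℕ} {r' : ℝ} (hr : 0 < r')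
    {B : Finset (Fin (N + 1))} {j : Fin (N + 1)} (hj : j ∉ B) :
    posGibbsMeasure (fun _ => (1 : ℝ)) (hsDiameter σ N) (N + 1)
        {x | ∀ b ∈ B, Torus.coarseCell r' (x b) = Torus.coarseCell r' (x j)} ≤
      (2 : ℝ≥0∞) ^ (B.card + 1) * ENNReal.ofReal (r' ^ 3) ^ B.card := by
  classical
  have hdep : ∀ x y : Fin (N + 1) → T3, (∀ b ∈ insert j B, x b = y b) →
      (x ∈ {x : Fin (N + 1) → T3 | ∀ b ∈ B, Torus.coarseCell r' (x b) = Torus.coarseCell r' (x j)} ↔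
        y ∈ {x : Fin (N + 1) → T3 | ∀ b ∈ B, Torus.coarseCell r' (x b) = Torus.coarseCell r' (x j)}) := by
    intro x y hxy
    simp only [mem_setOf_eq]
    rw [hxy j (Finset.mem_insert_self _ _)]
    exact forall₂_congr fun b hb => by rw [hxy b (Finset.mem_insert_of_mem hb)]
  have h1 := posGibbs_le_two_pow_mul_pi h (insert j B) (measurableSet_forall_sameCell r' B j) hdep
  rw [Finset.card_insert_of_notMem hj] at h1
  exact h1.trans (mul_le_mul_right (pi_forall_sameCell_le hr hj) _)

/-- **Tail of the occupancy of the cell of a tagged particle**: the canonical probability that the cell of particle `j`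
contains at least `M + 1` particles is at most `C(N, M) 2^{M+1} (r'³)^M` (union over the `M`-sets of partners).
[cite: Ruelle1969, §4.2] -/
theorem posGibbs_le_card_filter_le (h : SmallDensity uniformProfile σ) (N : ℕ) {r' : ℝ} (hr : 0 < r')
    (j : Fin (N + 1)) (M : ℕ) :
    posGibbsMeasure (fun _ => (1 : ℝ)) (hsDiameter σ N) (N + 1)
        {x | M + 1 ≤ (Finset.univ.filter fun l : Fin (N + 1) => Torus.coarseCell r' (x l) = Torus.coarseCell r' (x j)).card} ≤
      ((N.choose M : ℕ) : ℝ≥0∞) * ((2 : ℝ≥0∞) ^ (M + 1) * ENNReal.ofReal (r' ^ 3) ^ M) := by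
  classical
  set S : Finset (Finset (Fin (N + 1))) := (Finset.univ.erase j).powersetCard M with hS
  have hsub : {x : Fin (N + 1) → T3 | M + 1 ≤
        (Finset.univ.filter fun l : Fin (N + 1) => Torus.coarseCell r' (x l) = Torus.coarseCell r' (x j)).card} ⊆
      ⋃ B ∈ S, {x : Fin (N + 1) → T3 | ∀ b ∈ B, Torus.coarseCell r' (x b) = Torus.coarseCell r' (x j)} := by
    intro x hx
    set F := (Finset.univ.filter fun l : Fin (N + 1) => Torus.coarseCell r' (x l) = Torus.coarseCell r' (x j)).erase j
      with hF
    have hjmem : j ∈ (Finset.univ.filter fun l : Fin (N + 1) => Torus.coarseCell r' (x l) = Torus.coarseCell r' (x j)) :=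
      Finset.mem_filter.2 ⟨Finset.mem_univ _, rfl⟩
    have hFcard : M ≤ F.card := by
      have hc := Finset.card_erase_of_mem hjmem
      rw [hF, hc]
      exact Nat.le_sub_one_of_lt hx
    obtain ⟨B, hBF, hBcard⟩ := Finset.exists_subset_card_eq hFcard
    refine mem_iUnion₂.2 ⟨B, ?_, fun b hb => ?_⟩
    · rw [hS, Finset.mem_powersetCard]
      refine ⟨fun b hb => ?_, hBcard⟩
      have hb' := hBF hb
      rw [hF, Finset.mem_erase] at hb'
      exact Finset.mem_erase.2 ⟨hb'.1, Finset.mem_univ _⟩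
    · have hb' := hBF hb
      rw [hF, Finset.mem_erase, Finset.mem_filter] at hb'
      exact hb'.2.2
  calc posGibbsMeasure (fun _ => (1 : ℝ)) (hsDiameter σ N) (N + 1)
        {x | M + 1 ≤ (Finset.univ.filter fun l : Fin (N + 1) => Torus.coarseCell r' (x l) = Torus.coarseCell r' (x j)).card}
      ≤ posGibbsMeasure (fun _ => (1 : ℝ)) (hsDiameter σ N) (N + 1)
          (⋃ B ∈ S, {x : Fin (N + 1) → T3 | ∀ b ∈ B, Torus.coarseCell r' (x b) = Torus.coarseCell r' (x j)}) :=
        measure_mono hsub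
    _ ≤ ∑ B ∈ S, posGibbsMeasure (fun _ => (1 : ℝ)) (hsDiameter σ N) (N + 1)
          {x : Fin (N + 1) → T3 | ∀ b ∈ B, Torus.coarseCell r' (x b) = Torus.coarseCell r' (x j)} :=
        measure_biUnion_finset_le _ _
    _ ≤ ∑ _B ∈ S, (2 : ℝ≥0∞) ^ (M + 1) * ENNReal.ofReal (r' ^ 3) ^ M := by
        refine Finset.sum_le_sum fun B hB => ?_
        rw [hS, Finset.mem_powersetCard] at hB
        obtain ⟨hBsub, hBcard⟩ := hB
        have hjB : j ∉ B := fun hjB => by simpa using hBsub hjB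
        have h1 := posGibbs_forall_sameCell_le h hr hjB
        rwa [hBcard] at h1
    _ = ((N.choose M : ℕ) : ℝ≥0∞) * ((2 : ℝ≥0∞) ^ (M + 1) * ENNReal.ofReal (r' ^ 3) ^ M) := by
        rw [Finset.sum_const, hS, Finset.card_powersetCard, Finset.card_erase_of_mem (Finset.mem_univ j),
          Finset.card_univ, Fintype.card_fin, Nat.add_sub_cancel, nsmul_eq_mul]

/-- **Dense cells are unlikely**: the canonical probability that the cell of SOME particle holds more than
`κ (N+1) r'³` particles is at most `(N+1) · C(N, M) 2^{M+1} (r'³)^M`, `M = ⌊κ(N+1)r'³⌋` (`0 ≤ κ`). [cite: Ruelle1969, §4.2] -/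
theorem posGibbs_exists_denseCell_le (h : SmallDensity uniformProfile σ) (N : ℕ) {r' : ℝ} (hr : 0 < r')
    {κ : ℝ} (hκ : 0 ≤ κ) :
    posGibbsMeasure (fun _ => (1 : ℝ)) (hsDiameter σ N) (N + 1)
        {x | ∃ j : Fin (N + 1), κ * ((N + 1 : ℕ) : ℝ) * r' ^ 3 <
          ((Finset.univ.filter fun l : Fin (N + 1) => Torus.coarseCell r' (x l) = Torus.coarseCell r' (x j)).card : ℝ)} ≤
      ((N + 1 : ℕ) : ℝ≥0∞) * (((N.choose ⌊κ * ((N + 1 : ℕ) : ℝ) * r' ^ 3⌋₊ : ℕ) : ℝ≥0∞) *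
        ((2 : ℝ≥0∞) ^ (⌊κ * ((N + 1 : ℕ) : ℝ) * r' ^ 3⌋₊ + 1) *
          ENNReal.ofReal (r' ^ 3) ^ ⌊κ * ((N + 1 : ℕ) : ℝ) * r' ^ 3⌋₊)) := by
  set M : ℕ := ⌊κ * ((N + 1 : ℕ) : ℝ) * r' ^ 3⌋₊ with hM
  have hsub : {x : Fin (N + 1) → T3 | ∃ j : Fin (N + 1), κ * ((N + 1 : ℕ) : ℝ) * r' ^ 3 <
        ((Finset.univ.filter fun l : Fin (N + 1) => Torus.coarseCell r' (x l) = Torus.coarseCell r' (x j)).card : ℝ)} ⊆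
      ⋃ j : Fin (N + 1), {x | M + 1 ≤
        (Finset.univ.filter fun l : Fin (N + 1) => Torus.coarseCell r' (x l) = Torus.coarseCell r' (x j)).card} := by
    rintro x ⟨j, hj⟩
    refine mem_iUnion.2 ⟨j, ?_⟩
    have hMle : (M : ℝ) ≤ κ * ((N + 1 : ℕ) : ℝ) * r' ^ 3 := Nat.floor_le (by positivity)
    have hlt : (M : ℝ) < ((Finset.univ.filter fun l : Fin (N + 1) =>
      Torus.coarseCell r' (x l) = Torus.coarseCell r' (x j)).card : ℝ) := hMle.trans_lt hj
    exact Nat.succ_le_of_lt (by exact_mod_cast hlt)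
  calc posGibbsMeasure (fun _ => (1 : ℝ)) (hsDiameter σ N) (N + 1) _
      ≤ posGibbsMeasure (fun _ => (1 : ℝ)) (hsDiameter σ N) (N + 1) (⋃ j : Fin (N + 1), {x | M + 1 ≤
          (Finset.univ.filter fun l : Fin (N + 1) => Torus.coarseCell r' (x l) = Torus.coarseCell r' (x j)).card}) :=
        measure_mono hsub
    _ ≤ ∑ j : Fin (N + 1), posGibbsMeasure (fun _ => (1 : ℝ)) (hsDiameter σ N) (N + 1) {x | M + 1 ≤
          (Finset.univ.filter fun l : Fin (N + 1) => Torus.coarseCell r' (x l) = Torus.coarseCell r' (x j)).card} :=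
        measure_iUnion_fintype_le _ _
    _ ≤ ∑ _j : Fin (N + 1), ((N.choose M : ℕ) : ℝ≥0∞) * ((2 : ℝ≥0∞) ^ (M + 1) * ENNReal.ofReal (r' ^ 3) ^ M) :=
        Finset.sum_le_sum fun j _ => posGibbs_le_card_filter_le h N hr j M
    _ = ((N + 1 : ℕ) : ℝ≥0∞) * (((N.choose M : ℕ) : ℝ≥0∞) * ((2 : ℝ≥0∞) ^ (M + 1) * ENNReal.ofReal (r' ^ 3) ^ M)) := by
        rw [Finset.sum_const, Finset.card_univ, Fintype.card_fin, nsmul_eq_mul]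

/-- Real-valued form of `posGibbs_exists_denseCell_le`. [folklore] -/
theorem posGibbs_real_exists_denseCell_le (h : SmallDensity uniformProfile σ) (N : ℕ) {r' : ℝ} (hr : 0 < r')
    {κ : ℝ} (hκ : 0 ≤ κ) :
    (posGibbsMeasure (fun _ => (1 : ℝ)) (hsDiameter σ N) (N + 1)).real
        {x | ∃ j : Fin (N + 1), κ * ((N + 1 : ℕ) : ℝ) * r' ^ 3 <
          ((Finset.univ.filter fun l : Fin (N + 1) => Torus.coarseCell r' (x l) = Torus.coarseCell r' (x j)).card : ℝ)} ≤
      ((N + 1 : ℕ) : ℝ) * (((N.choose ⌊κ * ((N + 1 : ℕ) : ℝ) * r' ^ 3⌋₊ : ℕ) : ℝ) *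
        ((2 : ℝ) ^ (⌊κ * ((N + 1 : ℕ) : ℝ) * r' ^ 3⌋₊ + 1) * (r' ^ 3) ^ ⌊κ * ((N + 1 : ℕ) : ℝ) * r' ^ 3⌋₊)) := by
  have h1 := posGibbs_exists_denseCell_le h N hr hκ
  rw [measureReal_def]
  refine (ENNReal.toReal_mono ?_ h1).trans_eq ?_
  · exact ENNReal.mul_ne_top (ENNReal.natCast_ne_top _) (ENNReal.mul_ne_top (ENNReal.natCast_ne_top _)
      (ENNReal.mul_ne_top (ENNReal.pow_ne_top ENNReal.ofNat_ne_top) (ENNReal.pow_ne_top ENNReal.ofReal_ne_top)))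
  · rw [ENNReal.toReal_mul, ENNReal.toReal_mul, ENNReal.toReal_mul, ENNReal.toReal_pow, ENNReal.toReal_pow,
      ENNReal.toReal_natCast, ENNReal.toReal_natCast, ENNReal.toReal_ofReal (pow_nonneg hr.le 3), ENNReal.toReal_ofNat]

/-! ## The bound tends to zero exponentially fast -/

/-- **Algebra of the Ruelle bound**: with `M = ⌊κ(N+1)v⌋`, `0 < v`, `0 < κ`,
`(N+1)² C(N,M) 2^{M+1} v^M ≤ (2e/(κv)²) (M+1)² (2e/κ)^M`
(`C(N,M) ≤ (N+1)^M/M!`, `(N+1) v ≤ (M+1)/κ`, `(M+1)^{M+1}/(M+1)! ≤ e^{M+1}`). [folklore] -/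
theorem succ_sq_mul_choose_bound_le {N : ℕ} {v κ : ℝ} (hv : 0 < v) (hκ : 0 < κ) :
    ((N + 1 : ℕ) : ℝ) ^ 2 * (((N.choose ⌊κ * ((N + 1 : ℕ) : ℝ) * v⌋₊ : ℕ) : ℝ) *
        ((2 : ℝ) ^ (⌊κ * ((N + 1 : ℕ) : ℝ) * v⌋₊ + 1) * v ^ ⌊κ * ((N + 1 : ℕ) : ℝ) * v⌋₊)) ≤
      2 * Real.exp 1 / (κ * v) ^ 2 *
        (((⌊κ * ((N + 1 : ℕ) : ℝ) * v⌋₊ : ℝ) + 1) ^ 2 * (2 * Real.exp 1 / κ) ^ ⌊κ * ((N + 1 : ℕ) : ℝ) * v⌋₊) := by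
  set M : ℕ := ⌊κ * ((N + 1 : ℕ) : ℝ) * v⌋₊ with hM
  set n : ℝ := ((N + 1 : ℕ) : ℝ) with hn
  have hn0 : 0 < n := by rw [hn]; positivity
  have hM1 : κ * n * v < (M : ℝ) + 1 := Nat.lt_floor_add_one _
  have hM0 : (0 : ℝ) < (M : ℝ) + 1 := by positivity
  -- `n ≤ (M+1)/(κ v)` and `n v ≤ (M+1)/κ`
  have hnle : n ≤ ((M : ℝ) + 1) / (κ * v) := by
    rw [le_div_iff₀ (mul_pos hκ hv)]; nlinarith
  have hnv : n * v ≤ ((M : ℝ) + 1) / κ := by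
    rw [le_div_iff₀ hκ]; nlinarith
  -- `C(N, M) ≤ n^M / M!`
  have hchoose : ((N.choose M : ℕ) : ℝ) ≤ n ^ M / (M.factorial : ℝ) := by
    refine (Nat.choose_le_pow_div M N).trans ?_
    refine div_le_div_of_nonneg_right (pow_le_pow_left₀ (Nat.cast_nonneg _) ?_ M) (by positivity)
    rw [hn]; push_cast; linarith
  -- `(M+1)^M / M! ≤ e^{M+1}`
  have hfact : ((M : ℝ) + 1) ^ M / (M.factorial : ℝ) ≤ Real.exp 1 * Real.exp 1 ^ M := by
    have h1 := Real.pow_div_factorial_le_exp ((M : ℝ) + 1) hM0.le (M + 1)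
    have h2 : ((M : ℝ) + 1) ^ M / (M.factorial : ℝ) = ((M : ℝ) + 1) ^ (M + 1) / ((M + 1).factorial : ℝ) := by
      rw [Nat.factorial_succ, Nat.cast_mul, pow_succ]
      have hMf : (M.factorial : ℝ) ≠ 0 := by positivity
      push_cast
      field_simp
    rw [h2]
    refine h1.trans (le_of_eq ?_)
    rw [← pow_succ', Real.exp_one_pow]
    push_cast
    ring_nf
  -- assemble
  have hMf0 : (0 : ℝ) < (M.factorial : ℝ) := by positivity
  calc n ^ 2 * (((N.choose M : ℕ) : ℝ) * ((2 : ℝ) ^ (M + 1) * v ^ M))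
      ≤ n ^ 2 * (n ^ M / (M.factorial : ℝ) * ((2 : ℝ) ^ (M + 1) * v ^ M)) := by gcongr
    _ = 2 * n ^ 2 * ((2 * (n * v)) ^ M / (M.factorial : ℝ)) := by rw [mul_pow, mul_pow, pow_succ]; ring
    _ ≤ 2 * (((M : ℝ) + 1) / (κ * v)) ^ 2 * ((2 * (((M : ℝ) + 1) / κ)) ^ M / (M.factorial : ℝ)) := by gcongr
    _ = 2 / (κ * v) ^ 2 * (((M : ℝ) + 1) ^ 2 * (2 / κ) ^ M) * (((M : ℝ) + 1) ^ M / (M.factorial : ℝ)) := by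
        rw [div_pow, mul_pow (2 : ℝ), div_pow, div_pow]
        field_simp
    _ ≤ 2 / (κ * v) ^ 2 * (((M : ℝ) + 1) ^ 2 * (2 / κ) ^ M) * (Real.exp 1 * Real.exp 1 ^ M) := by gcongr
    _ = 2 * Real.exp 1 / (κ * v) ^ 2 * (((M : ℝ) + 1) ^ 2 * (2 * Real.exp 1 / κ) ^ M) := by
        rw [div_pow, div_pow, mul_pow]; ring

/-- `(M+1)² q^M → 0` for `|q| < 1`. [folklore] -/
theorem tendsto_succ_sq_mul_pow {q : ℝ} (hq0 : 0 < q) (hq : q < 1) :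
    Tendsto (fun M : ℕ => ((M : ℝ) + 1) ^ 2 * q ^ M) atTop (𝓝 0) := by
  have h1 := (tendsto_pow_const_mul_const_pow_of_abs_lt_one 2 (show |q| < 1 by rwa [abs_of_pos hq0])).comp
    (tendsto_add_atTop_nat 1)
  have h2 := h1.const_mul q⁻¹
  rw [mul_zero] at h2
  refine h2.congr fun M => ?_
  simp only [Function.comp_apply]
  push_cast
  field_simp
  ring

/-- **The Ruelle bound tends to zero**: for `0 < v` and `κ ≥ 6` (so that `2e/κ < 1`),
`(N+1)² C(N,M_N) 2^{M_N+1} v^{M_N} → 0`, `M_N = ⌊κ(N+1)v⌋`. [folklore] -/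
theorem tendsto_denseCell_bound {v κ : ℝ} (hv : 0 < v) (hκ : 6 ≤ κ) :
    Tendsto (fun N : ℕ => ((N + 1 : ℕ) : ℝ) ^ 2 * (((N.choose ⌊κ * ((N + 1 : ℕ) : ℝ) * v⌋₊ : ℕ) : ℝ) *
        ((2 : ℝ) ^ (⌊κ * ((N + 1 : ℕ) : ℝ) * v⌋₊ + 1) * v ^ ⌊κ * ((N + 1 : ℕ) : ℝ) * v⌋₊))) atTop (𝓝 0) := by
  have hκ0 : 0 < κ := by linarith
  have he : Real.exp 1 < 3 := Real.exp_one_lt_d9.trans (by norm_num)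
  have hq0 : 0 < 2 * Real.exp 1 / κ := by positivity
  have hq1 : 2 * Real.exp 1 / κ < 1 := by rw [div_lt_one hκ0]; linarith
  -- `M_N → ∞`
  have hMN : Tendsto (fun N : ℕ => ⌊κ * ((N + 1 : ℕ) : ℝ) * v⌋₊) atTop atTop := by
    refine tendsto_nat_floor_atTop.comp ?_
    have h1 : Tendsto (fun N : ℕ => ((N + 1 : ℕ) : ℝ)) atTop atTop :=
      (tendsto_natCast_atTop_atTop (R := ℝ)).comp (tendsto_add_atTop_nat 1)
    have h2 := (h1.const_mul_atTop hκ0).atTop_mul_const hv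
    exact h2
  have hg : Tendsto (fun N : ℕ => 2 * Real.exp 1 / (κ * v) ^ 2 *
      (((⌊κ * ((N + 1 : ℕ) : ℝ) * v⌋₊ : ℝ) + 1) ^ 2 * (2 * Real.exp 1 / κ) ^ ⌊κ * ((N + 1 : ℕ) : ℝ) * v⌋₊)) atTop (𝓝 0) := by
    have h := ((tendsto_succ_sq_mul_pow hq0 hq1).comp hMN).const_mul (2 * Real.exp 1 / (κ * v) ^ 2)
    rw [mul_zero] at h
    exact h
  refine squeeze_zero (fun N => by positivity) (fun N => succ_sq_mul_choose_bound_le hv hκ0) hg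

/-- **The packaged large-deviation bound consumed by a union bound over `O(N+1)` windows**: at small density, for a
constant activity `a > 0`, a cell size `0 < r'`, a threshold `κ ≥ 6` and every `δ > 0`, for all `N` large enough
`(N+1) · P_N(∃ j, κ(N+1)r'³ < #{l : cell_l = cell_j}) ≤ δ` (`P_N = posGibbsMeasure a ε_N (N+1)`, whose dependence on
the value of the constant activity is void). [cite: Ruelle1969, §4.2] -/
theorem exists_forall_succ_mul_posGibbs_real_le (h : SmallDensity uniformProfile σ) {a : ℝ} (ha : 0 < a) {r' : ℝ}
    (hr : 0 < r') {κ : ℝ} (hκ : 6 ≤ κ) {δ : ℝ} (hδ : 0 < δ) :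
    ∃ N₀ : ℕ, ∀ N : ℕ, N₀ ≤ N → ((N + 1 : ℕ) : ℝ) *
      (posGibbsMeasure (fun _ : T3 => a) (hsDiameter σ N) (N + 1)).real
        {x | ∃ j : Fin (N + 1), κ * ((N + 1 : ℕ) : ℝ) * r' ^ 3 <
          ((Finset.univ.filter fun l : Fin (N + 1) => Torus.coarseCell r' (x l) = Torus.coarseCell r' (x j)).card : ℝ)} ≤ δ := by
  have hκ0 : 0 ≤ κ := by linarith
  have hlim := tendsto_denseCell_bound (pow_pos hr 3) hκ
  obtain ⟨N₀, hN₀⟩ := eventually_atTop.1 (hlim.eventually (gt_mem_nhds hδ))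
  refine ⟨N₀, fun N hN => ?_⟩
  have hPa : posGibbsMeasure (fun _ : T3 => a) (hsDiameter σ N) (N + 1) =
      posGibbsMeasure (fun _ : T3 => (1 : ℝ)) (hsDiameter σ N) (N + 1) := by
    rw [posGibbsMeasure_eq continuous_const (fun _ => ha), posGibbsMeasure_eq continuous_const (fun _ => one_pos),
      profileOf_const ha, profileOf_const one_pos]
  rw [hPa]
  refine le_trans ?_ (hN₀ N hN).le
  calc ((N + 1 : ℕ) : ℝ) * (posGibbsMeasure (fun _ : T3 => (1 : ℝ)) (hsDiameter σ N) (N + 1)).real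
        {x | ∃ j : Fin (N + 1), κ * ((N + 1 : ℕ) : ℝ) * r' ^ 3 <
          ((Finset.univ.filter fun l : Fin (N + 1) => Torus.coarseCell r' (x l) = Torus.coarseCell r' (x j)).card : ℝ)}
      ≤ ((N + 1 : ℕ) : ℝ) * (((N + 1 : ℕ) : ℝ) * (((N.choose ⌊κ * ((N + 1 : ℕ) : ℝ) * r' ^ 3⌋₊ : ℕ) : ℝ) *
          ((2 : ℝ) ^ (⌊κ * ((N + 1 : ℕ) : ℝ) * r' ^ 3⌋₊ + 1) * (r' ^ 3) ^ ⌊κ * ((N + 1 : ℕ) : ℝ) * r' ^ 3⌋₊))) :=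
        mul_le_mul_of_nonneg_left (posGibbs_real_exists_denseCell_le h N hr hκ0) (Nat.cast_nonneg _)
    _ = ((N + 1 : ℕ) : ℝ) ^ 2 * (((N.choose ⌊κ * ((N + 1 : ℕ) : ℝ) * r' ^ 3⌋₊ : ℕ) : ℝ) *
          ((2 : ℝ) ^ (⌊κ * ((N + 1 : ℕ) : ℝ) * r' ^ 3⌋₊ + 1) * (r' ^ 3) ^ ⌊κ * ((N + 1 : ℕ) : ℝ) * r' ^ 3⌋₊)) := by ring

end Literature.MathematicalPhysics.KineticTheory

end
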